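import Summits.Ventures.Crystal3D.Kissing125.Estimates3
import HarnessLib

/-!
# The main estimate (Hales Thm 2, `d₃`) and the census `≥ 23 contacts` — K25 copy at `κ = 7/32` (`h = 5/4`), part 4/4

HONEST FRAMING (cell pub-crystal3d, K-path at `h = 5/4`): this is NOT a result printed by Hales.  It is his
METHOD (arXiv:1209.6043, Theorem 3: the main estimate + the classification of the contact graphs of kissing
configurations, in the tree's form of a verified interval-arithmetic growth search, `Literature/…/KissingSearch*.lean`)
RE-RUN at the separation `5/2` instead of `2h₀ = 2.52` (largest long-side cosine `κ = 1 − (5/4)²/2 = 7/32` instead of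
`κ₀ = 1031/5000`).  The declarations are namespace-shadowing COPIES of the tree's declarations (same names, inside
`namespace Summit.Ventures.Crystal3D.Kissing125[.KissingSearch]`, original docstrings and citation tags kept — the tags
name the printed METHOD step each declaration implements); the diff to the originals is stated per file.  Generated by
`HOME/lean/kissing125/gen/mkfiles.py`; audit recipe in `HOME/lean/kissing125/README.md`.  Nothing here is asserted
about GAP(1.26) or any census.

THIS FILE: the κ-DEPENDENT declarations of `KissingMainEstimate` / `KissingFacetPenalty` / `KissingFacetPenaltyRefined` / `KissingTriangleDeficit` / `KissingContactCount` with `1031/5000 ↦ 7/32`, the `d₃` constants `0.103/0.27/0.36/0.5/0.63 ↦ 0.1/0.26/0.34/0.475/0.61` (corner principle on the new boxes; rational waypoints `575/2808`, `0.312`, `0.373`, `0.484`, `0.607`; `0.49` unchanged), the unit price `0.103 ↦ 0.1`, and the budget `1.62 ↦ 1.56` via the new `lt_hales_sol0_5504` (`sol₀ > 0.5504`, two half-angle steps) / `budget_lt_156`; `fanPenaltyLB_eq` re-proved for the shadowing `fanPenaltyLB`. κ-independent lemmas (`contactCount`, `triangleUnits`, deficits/supplies, `EdgeDeficit`, `FanCensus`,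 `ContactCount` A–B, …) are the tree's, unchanged. Headline: `twentythree_le_card_contactPairsAt` at `7/32`.  (Part 4 of 4: lines 833–874 of the transformed copy; the split is only for the 400-line rule.)

## References
* T. C. Hales, *A proof of Fejes Tóth's conjecture on sphere packings with kissing number twelve*,
  arXiv:1209.6043 (2012): Definition 1, Theorem 2 (main estimate `d₃`), Theorem 3, Lemmas 7–10. [`Hales2012`]
* R. E. Moore, *Interval Analysis* (1966), Theorem 3.1, §4.4. [`Moore1966`]
-/

noncomputable section

namespace Summit.Ventures.Crystal3D.Kissing125
open Literature.Geometry.DiscreteGeometry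
open Real RealInnerProductSpace InnerProductGeometry Finset

section Census
variable {X : Finset (EuclideanSpace ℝ (Fin 3))}

/-- **The budget is `< 1.56`** (`4π − 20 sol₀ ≈ 1.5407`). [cite: Hales2012, Lemma 5] -/
theorem budget_lt_156 : 4 * π - 20 * hales_sol0 < 1.56 := by
  have hπ := pi_lt_d6
  have hs := lt_hales_sol0_5504
  norm_num at hπ hs ⊢
  linarith

/-- **Twelve unit vectors whose distinct pairs have inner product `1/2` or `≤ κ₀` have at least
`23` contact pairs**, K25 version at `κ = 7/32` (`0.1 (60 − 2c) ≤ Σ 0.1·units ≤ Σ fanPenaltyLB₂ ≤ 4π − 20 sol₀ < 1.56`,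
and `0.1 · 16 > 1.56`). [cite: Hales2012, proof of Theorem 3 (weights; method at κ = 7/32)] -/
theorem twentythree_le_card_contactPairsAt (h12 : X.card = 12) (hX1 : ∀ y ∈ X, ‖y‖ = 1)
    (hV : ∀ y ∈ X, ∀ y' ∈ X, y ≠ y' → ⟪y, y'⟫ = 1 / 2 ∨ ⟪y, y'⟫ ≤ 7 / 32) :
    23 ≤ (contactPairsAt X (1 / 2)).card := by
  have hp : ∀ y ∈ X, ∀ y' ∈ X, y ≠ y' → ⟪y, y'⟫ ≤ 1 / 2 := fun y hy y' hy' h =>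
    (hV y hy y' hy' h).elim le_of_eq fun h' => by linarith
  have hU := sum_sum_fanUnits_ge h12 hX1 hp
  have hB := sum_sum_fanPenaltyLB₂_le h12 hX1 hV
  have hcmp : ∑ c ∈ facetNormals X, ∑ i ∈ range ((tightSet X c).card - 2), 0.1 * fanUnits X c i ≤
      ∑ c ∈ facetNormals X, ∑ i ∈ range ((tightSet X c).card - 2), fanPenaltyLB₂ X c i :=
    Finset.sum_le_sum fun c _ => Finset.sum_le_sum fun i _ => mul_fanUnits_le_fanPenaltyLB₂ X c i
  rw [Finset.sum_congr rfl fun c _ => (Finset.mul_sum _ _ _).symm, ← Finset.mul_sum] at hcmp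
  have hlt := budget_lt_156
  have hreal : (23 : ℝ) ≤ (contactPairsAt X (1 / 2)).card := by
    by_contra hcon
    push Not at hcon
    have h22 : ((contactPairsAt X (1 / 2)).card : ℝ) ≤ 22 := by
      have : (contactPairsAt X (1 / 2)).card ≤ 22 := by
        by_contra h; push Not at h
        have : (23 : ℝ) ≤ (contactPairsAt X (1 / 2)).card := by exact_mod_cast h
        linarith
      exact_mod_cast this
    norm_num at hcmp hlt
    nlinarith
  exact_mod_cast hreal

end Census


end Summit.Ventures.Crystal3D.Kissing125

end


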